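import Summits.AtomisticToContinuum.Crystallization.Theorems.FrustratedLawDichotomyStrainedPatchHomTubeIso

/-!
# The ELASTIC piece cut by STACKING PHASE: finite word core ∧ far fault ∧ long-wave pure stacking («PhaseCut», lens-5 g46 §B; critic ROWS 800 (iv) / 818 (C))

Lens «finite/base range + asymptotic regime + bridge» applied INSIDE the elastic piece `CleanTextureFloor r` of «CleanCollar» (p843760), below the
isometry-quotiented tube of «HomTubeIso».  `GoodAtScale η D y i` is a disjunction of an fcc-pattern fit and an hcp-pattern fit; §3 names the disjuncts
(`FccGoodAtScale`, `HcpGoodAtScale`; `goodAtScale_iff_fcc_or_hcp`; isometry-invariant) and the PURE-WORD predicate `MonoPhaseBall r₁ z c` := every site within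
`r₁` of the centre is fcc-good at (`1/8`, `3/2`), or every one is hcp-good (local, decidable; implies `CleanBall r₁`).  Pieces (all with an explicit floor `φ`):
* `PolyTextureFloor r r₁ φ` **[OT-F, NEAR-FAULT; FINITE]** — clean within `r`, an fcc-type AND an hcp-type site within `r₁`: finitely many Barlow stacking words
  across the `2r₁`-core, each a bounded-dimensional certified minimisation like (H) (instrument: per-word B&B; on file g45 `out/FAULT.md`: admissible clean
  faulted states need slack `t ≥ .014` and have `S ≥ 4.40e-3`, `4.4×` the floor `1/1000`).
* `AnnularPhaseFloor r r₁ r₂ φ` **[FF, FAR-FAULT; BRIDGE]** — pure word out to `r₁`, first word change in `(r₁, r₂]`: beyond `r₁ = 24/5 = 9/5 + 3` a re-stacked site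
  reaches a member only through the splice window of `W₄₅` (`|W₄₅| ≤ 2.3e-4` per pair; whole tail beyond `24/5` is `−5.2e-4`, CleanCollar §7) — PERTURBATIVE.
* `MonoTextureFloor r r₂ φ` **[PURE STACKING out to `r₂`]**, cut by the isometry-quotiented tube (§5): `MonoTubeFloor r r₂ ε` **[TUBE; PROVED from (H) + `TubeRelief`]**
  ∧ `MonoOffTubeFloor r r₂ ε φ` **[OT-G, GRADIENT branch = the RESIDUAL; ASYMPTOTIC]** — single-phase clean admissible textures at isometry-distance `≥ ε` from every
  admissible homogeneous instance: NON-AFFINE single crystals (strain gradient / lattice curvature across the `63/10`-ball).  Mechanism memo NODE-g46 §C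
  «first-order optimality at the cap-riding corner»: at the knife edge the admissible set is a CORNER (every member rides the misfit edge: `η ∈ [0.0505, 0.0508]` vs
  `1/20` at RD_jz0w52s), so local
  minimality of the score over gradient modes is a LINEAR programme — the hcp per-site third-moment (flexo) coefficient against the slack tax of riding the
  edge (`+1.3e-4` per `.001` misfit) — not a second-variation condition; pilot `g46/scripts/bend46.py`: at the knife-edge texture `RD_jz0w52s` the 24-mode descent LP (6
  uniform strains + 18 quadratic gradient fields, linearised misfit / force-cap / box rows) is first-order BLOCKED — `λ* = −2.4e-6 ≈ 0`, held by 16 force-cap and 6 misfit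
  rows, validated `S` RISES — and slack harvesting lowers the admissible clean record only to `S = 1.799e-3` (margin `1.80×` over `1/1000`); census L5-ASK4b.
PROVED: exact cuts at every dial (`em` on `MonoPhaseBall` / `NearHomIso`), necessity of every piece at floor `0`, seams for floors `≥ 0`, dials, the PHASE LADDER
`MonoTextureFloor r r₁ φ ↔ MonoTextureFloor r r₂ φ ∧ AnnularPhaseFloor r r₁ r₂ φ`, THREE PHASE REGIMES, the conservative link `MonoOffTubeFloor ∧ PolyTextureFloor →
OffTubeFloorIso`, and the RECORD NODE (dials `r = r₂ = 63/10`, `r₁ = 24/5`, `ε = 1/100`; floors `1/1000`, the [OT-G] / [FF] floors PROVISIONAL pending L5-ASK4b):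
`HomFloor (1/625) → TubeRelief (63/10) (1/100) 0 (1/1000) → MonoOffTubeFloor (63/10) (63/10) (1/100) (1/1000) → AnnularPhaseFloor (63/10) (24/5) (63/10) (1/1000) →
PolyTextureFloor (63/10) (24/5) (1/1000) → AnnularDefectFloor (24/5) (63/10) → DefectiveCollarFloor (24/5) → StrainedPatchRec` (+ the `h1` form of `…CollarCensusZeroFree`).
TAGS: (H) CERT-in-flight · [TR] PERTURBATIVE · [OT-G] UNDECIDED·IDEA-NEEDED·INSTRUMENTABLE (residual; KILL = an admissible clean single-phase texture with
`ε*_iso > 1/100` and `S < 1/1000`, or any admissible texture with `S < 0`) · [FF] PERTURBATIVE·INSTRUMENTABLE · [OT-F] INSTRUMENTABLE (finite word catalogue) ·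
[FD] PERTURBATIVE · [ND] UNDECIDED·IDEA-NEEDED (unchanged).  HONESTY: a case split whose content is WHERE it cuts — a DECIDABLE phase predicate separating the
finite stacking-word core (certified computation) from the long-wave single-phase regime (Cauchy–Born + strain gradient at a corner), joined by proved seams and the
tail budget; no piece alone gives the elastic piece or another piece (must-fail probes `g46/check/PhaseCutProbes.lean`).  No new axioms, no sorry, no instances / notation.
Evidence: `run/shared/lean/pub/decomp-a2c/decomp-a2c-lens-5/g46/{NODE-g46.md, out/, scripts/, check/}`.
-/

namespace Summit.AtomisticToContinuum.Crystallization.Theorems.FrustratedLawDichotomyStrainedPatchPhaseCut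

open scoped BigOperators Classical
open Summit.AtomisticToContinuum.Crystallization.Theorems.FrustratedLawDichotomyRangeCut
open Summit.AtomisticToContinuum.Crystallization.Theorems.FrustratedLawDichotomySchurCut
open Summit.AtomisticToContinuum.Crystallization.Theorems.FrustratedLawDichotomyMotifLemmas
open Summit.AtomisticToContinuum.Crystallization.Theorems.FrustratedLawDichotomyAveragingCut
open Summit.AtomisticToContinuum.Crystallization.Theorems.FrustratedLawDichotomyAveragingRuleCap
open Summit.AtomisticToContinuum.Crystallization.Theorems.FrustratedLawDichotomyAveragingRuleTightFree
open Summit.AtomisticToContinuum.Crystallization.Theorems.FrustratedLawDichotomyRuleToolkitGood (goodFlag)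
open Summit.AtomisticToContinuum.Crystallization.Theorems.FrustratedLawDichotomyExemptDoor (SitePred)
open Summit.AtomisticToContinuum.Crystallization.Theorems.FrustratedLawDichotomyExemptAbsorption
open Summit.AtomisticToContinuum.Crystallization.Theorems.FrustratedLawDichotomyExemptAbsorptionRecord
open Summit.AtomisticToContinuum.Crystallization.Theorems.FrustratedLawDichotomyCollarCensus
open Summit.AtomisticToContinuum.Crystallization.Theorems.FrustratedLawDichotomyCollarCensusKappa
open Summit.AtomisticToContinuum.Crystallization.Theorems.FrustratedLawDichotomyStrainedPatchHomSplit
open Summit.AtomisticToContinuum.Crystallization.Theorems.FrustratedLawDichotomyStrainedPatchCleanCollar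
open Summit.AtomisticToContinuum.Crystallization.Theorems.FrustratedLawDichotomyStrainedPatchHomTube
open Summit.AtomisticToContinuum.Crystallization.Theorems.FrustratedLawDichotomyStrainedPatchHomIsometry

open Summit.AtomisticToContinuum.Crystallization.Theorems.FrustratedLawDichotomyStrainedPatchHomTubeIso
variable {N : ℕ}

/-! ## §3. The two stacking phases of a clean site -/

/-- **`FitAtScale P ηmax D y i`** — the text of ONE branch of `GoodAtScale ηmax D y i` for the kissing pattern `P : ι → E3`: a capped-scale, `η`-misfit,
isometrically placed copy of the pattern realised by sites of the cluster, pinned at the nearest-neighbour distance, with a clean gap below `13/10·d`. -/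
def FitAtScale {ι : Type*} (P : ι → E3) (ηmax D : ℝ) {N : ℕ} (y : Fin N → E3) (i : Fin N) : Prop :=
  ∃ (d η γ : ℝ) (A : E3 →ₗᵢ[ℝ] E3), d ≤ D ∧ ∃ t : ι → E3, 0 < d ∧ 0 < γ ∧ η < ηmax ∧
    (∀ u : ι, t u ∈ Set.range y ∧ ‖(t u - y i) - d • A (P u)‖ ≤ η * d) ∧
    (∀ s : E3, s ∈ Set.range y → s ≠ y i → d ≤ dist s (y i)) ∧
    (∃ s : E3, s ∈ Set.range y ∧ s ≠ y i ∧ dist s (y i) ≤ d) ∧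
    (∀ s : E3, s ∈ Set.range y → s ≠ y i → dist s (y i) < 13 / 10 * d + γ → dist s (y i) ≤ 13 / 10 * d - γ ∧ s ∈ Set.range t)

/-- **`FccGoodAtScale ηmax D y i`** — the fcc (cuboctahedral) branch of `GoodAtScale`. -/
def FccGoodAtScale (ηmax D : ℝ) {N : ℕ} (y : Fin N → E3) (i : Fin N) : Prop :=
  FitAtScale (fun u : ↥Literature.Geometry.DiscreteGeometry.fccKissingPattern => (u : E3)) ηmax D y i

/-- **`HcpGoodAtScale ηmax D y i`** — the hcp (anticuboctahedral) branch of `GoodAtScale`. -/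
def HcpGoodAtScale (ηmax D : ℝ) {N : ℕ} (y : Fin N → E3) (i : Fin N) : Prop :=
  FitAtScale (fun u : ↥Literature.Geometry.DiscreteGeometry.hcpKissingPattern => (u : E3)) ηmax D y i

/-- ★ `GoodAtScale η D y i ↔ FccGoodAtScale η D y i ∨ HcpGoodAtScale η D y i` (the definition, re-associated). [formal bookkeeping] -/
theorem goodAtScale_iff_fcc_or_hcp {η D : ℝ} {N : ℕ} {y : Fin N → E3} {i : Fin N} :
    GoodAtScale η D y i ↔ FccGoodAtScale η D y i ∨ HcpGoodAtScale η D y i := by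
  constructor
  · rintro ⟨d, η', γ, A, hd, h | h⟩
    · exact Or.inl ⟨d, η', γ, A, hd, h⟩
    · exact Or.inr ⟨d, η', γ, A, hd, h⟩
  · rintro (⟨d, η', γ, A, hd, h⟩ | ⟨d, η', γ, A, hd, h⟩)
    · exact ⟨d, η', γ, A, hd, Or.inl h⟩
    · exact ⟨d, η', γ, A, hd, Or.inr h⟩

/-- A pattern fit transports along a linear isometry (`A ↦ R ∘ A`, `t ↦ R ∘ t`; the proof of `…HomIsometry.goodAtScale_comp`, one branch). [folklore] -/
theorem fitAtScale_comp {ι : Type*} (P : ι → E3) {η D : ℝ} (R : E3 ≃ₗᵢ[ℝ] E3) {y : Fin N → E3} {i : Fin N}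
    (h : FitAtScale P η D y i) : FitAtScale P η D (⇑R ∘ y) i := by
  obtain ⟨d, η', γ, A, hdD, t, hd, hγ, hη, hT, hpin, hpin', hgap⟩ := h
  have hdist : ∀ s : E3, dist s ((⇑R ∘ y) i) = dist (R.symm s) (y i) := fun s => by
    rw [Function.comp_apply, ← R.dist_map (R.symm s) (y i), LinearIsometryEquiv.apply_symm_apply]
  have hne : ∀ s : E3, s ≠ (⇑R ∘ y) i ↔ R.symm s ≠ y i := fun s => by
    rw [Function.comp_apply, not_iff_not]
    constructor
    · rintro rfl; simp
    · intro hs; rw [← hs]; simp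
  refine ⟨d, η', γ, R.toLinearIsometry.comp A, hdD, fun u => R (t u), hd, hγ, hη, fun u => ⟨?_, ?_⟩, fun s hs hsi => ?_, ?_,
    fun s hs hsi hlt => ?_⟩
  · obtain ⟨k, hk⟩ := (hT u).1; exact ⟨k, by simp [hk]⟩
  · have := (hT u).2
    calc ‖(R (t u) - (⇑R ∘ y) i) - d • (R.toLinearIsometry.comp A) (P u)‖
        = ‖R ((t u - y i) - d • A (P u))‖ := by simp [map_sub, map_smul]
      _ ≤ η' * d := by rw [LinearIsometryEquiv.norm_map]; exact this
  · rw [hdist]; exact hpin _ ((mem_range_comp_iff R y s).1 hs) ((hne s).1 hsi)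
  · obtain ⟨s, hs, hsi, hle⟩ := hpin'
    refine ⟨R s, (mem_range_comp_iff R y _).2 (by simpa using hs), ?_, ?_⟩
    · exact (hne (R s)).2 (by simpa using hsi)
    · rw [hdist]; simpa using hle
  · rw [hdist] at hlt ⊢
    obtain ⟨hle, ⟨u, hu⟩⟩ := hgap _ ((mem_range_comp_iff R y s).1 hs) ((hne s).1 hsi) hlt
    exact ⟨hle, ⟨u, by simp [hu]⟩⟩

/-- `FitAtScale P η D (R ∘ y) i ↔ FitAtScale P η D y i`. [folklore] -/
theorem fitAtScale_comp_iff {ι : Type*} (P : ι → E3) {η D : ℝ} (R : E3 ≃ₗᵢ[ℝ] E3) (y : Fin N → E3) (i : Fin N) :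
    FitAtScale P η D (⇑R ∘ y) i ↔ FitAtScale P η D y i :=
  ⟨fun h => by simpa only [symm_comp_comp] using fitAtScale_comp P R.symm h, fitAtScale_comp P R⟩

/-- The fcc phase is isometry-invariant. [folklore] -/
theorem fccGoodAtScale_comp_iff {η D : ℝ} (R : E3 ≃ₗᵢ[ℝ] E3) (y : Fin N → E3) (i : Fin N) :
    FccGoodAtScale η D (⇑R ∘ y) i ↔ FccGoodAtScale η D y i :=
  fitAtScale_comp_iff _ R y i

/-- The hcp phase is isometry-invariant. [folklore] -/
theorem hcpGoodAtScale_comp_iff {η D : ℝ} (R : E3 ≃ₗᵢ[ℝ] E3) (y : Fin N → E3) (i : Fin N) :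
    HcpGoodAtScale η D (⇑R ∘ y) i ↔ HcpGoodAtScale η D y i :=
  fitAtScale_comp_iff _ R y i

/-- **`MonoPhaseBall r₁ z c`** — a PURE STACKING WORD out to `r₁`: every site within `r₁` of the centre is fcc-good at (`1/8`, `3/2`), or every one is
hcp-good.  Local and decidable from the positions within `r₁ + 3` of the centre. -/
def MonoPhaseBall (r₁ : ℝ) {M : ℕ} (z : Fin M → E3) (c : Fin M) : Prop :=
  (∀ a : Fin M, dist (z a) (z c) ≤ r₁ → FccGoodAtScale (1 / 8) (3 / 2) z a) ∨
    (∀ a : Fin M, dist (z a) (z c) ≤ r₁ → HcpGoodAtScale (1 / 8) (3 / 2) z a)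

/-- A pure word is clean. [folklore] -/
theorem MonoPhaseBall.cleanBall {r₁ : ℝ} {M : ℕ} {z : Fin M → E3} {c : Fin M} (h : MonoPhaseBall r₁ z c) : CleanBall r₁ z c := by
  rcases h with h | h
  · exact fun a ha => goodAtScale_iff_fcc_or_hcp.2 (Or.inl (h a ha))
  · exact fun a ha => goodAtScale_iff_fcc_or_hcp.2 (Or.inr (h a ha))

/-- `MonoPhaseBall` is antitone in the radius. [formal bookkeeping] -/
theorem MonoPhaseBall.mono {r₁ r₁' : ℝ} {M : ℕ} {z : Fin M → E3} {c : Fin M} (h : MonoPhaseBall r₁' z c) (hle : r₁ ≤ r₁') :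
    MonoPhaseBall r₁ z c :=
  h.imp (fun h a ha => h a (ha.trans hle)) (fun h a ha => h a (ha.trans hle))

/-- `MonoPhaseBall r₁ (R ∘ z) c ↔ MonoPhaseBall r₁ z c`. [folklore] -/
theorem monoPhaseBall_comp_iff (R : E3 ≃ₗᵢ[ℝ] E3) {r₁ : ℝ} {M : ℕ} (z : Fin M → E3) (c : Fin M) :
    MonoPhaseBall r₁ (⇑R ∘ z) c ↔ MonoPhaseBall r₁ z c := by
  simp only [MonoPhaseBall, dist_comp, fccGoodAtScale_comp_iff, hcpGoodAtScale_comp_iff]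

/-! ## §4. The elastic piece cut by phase: pure stacking ∧ near-fault, the phase ladder, three phase regimes -/

/-- **`MonoTextureFloor r r₁ φ` [PURE STACKING out to `r₁`]** — on admissible clusters clean within `r` with a pure word out to `r₁`, the score is `≥ φ`. -/
def MonoTextureFloor (r r₁ φ : ℝ) : Prop :=
  ∀ (M : ℕ) (z : Fin M → E3) (c : Fin M), Admissible M z c → CleanBall r z c → MonoPhaseBall r₁ z c → φ ≤ ballAvg (9 / 5) z (xRec M z) c

/-- **`PolyTextureFloor r r₁ φ` [OT-F, NEAR-FAULT; finite stacking-word catalogue]** — on admissible clusters clean within `r` WITHOUT a pure word out to `r₁`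
(an fcc-type and an hcp-type site both within `r₁`), the score is `≥ φ`. -/
def PolyTextureFloor (r r₁ φ : ℝ) : Prop :=
  ∀ (M : ℕ) (z : Fin M → E3) (c : Fin M), Admissible M z c → CleanBall r z c → ¬MonoPhaseBall r₁ z c → φ ≤ ballAvg (9 / 5) z (xRec M z) c

/-- **`AnnularPhaseFloor r r₁ r₂ φ` [FF, FAR-FAULT; tail budget]** — clean within `r`, pure word out to `r₁`, first word change in the annulus `(r₁, r₂]`. -/
def AnnularPhaseFloor (r r₁ r₂ φ : ℝ) : Prop :=
  ∀ (M : ℕ) (z : Fin M → E3) (c : Fin M), Admissible M z c → CleanBall r z c → MonoPhaseBall r₁ z c → ¬MonoPhaseBall r₂ z c →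
    φ ≤ ballAvg (9 / 5) z (xRec M z) c

/-- ★ EXACT PHASE CUT (every dial): `CleanTextureFloorAt r φ ↔ MonoTextureFloor r r₁ φ ∧ PolyTextureFloor r r₁ φ`. [folklore: `em` on `MonoPhaseBall r₁`] -/
theorem cleanTextureFloorAt_iff_mono_and_poly (r r₁ φ : ℝ) : CleanTextureFloorAt r φ ↔ MonoTextureFloor r r₁ φ ∧ PolyTextureFloor r r₁ φ := by
  constructor
  · intro h
    exact ⟨fun M z c hz hcl _ => h M z c hz hcl, fun M z c hz hcl _ => h M z c hz hcl⟩
  · rintro ⟨hM, hP⟩ M z c hz hcl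
    by_cases hm : MonoPhaseBall r₁ z c
    · exact hM M z c hz hcl hm
    · exact hP M z c hz hcl hm

/-- ★ … at floor `0`: `CleanTextureFloor r ↔ MonoTextureFloor r r₁ 0 ∧ PolyTextureFloor r r₁ 0`. [folklore] -/
theorem cleanTextureFloor_iff_mono_and_poly (r r₁ : ℝ) : CleanTextureFloor r ↔ MonoTextureFloor r r₁ 0 ∧ PolyTextureFloor r r₁ 0 :=
  cleanTextureFloorAt_iff_mono_and_poly r r₁ 0

/-- NECESSITY: the pure-stacking piece at floor `0` is a restriction of the elastic piece. [folklore] -/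
theorem monoTextureFloor_zero_of_cleanTextureFloor {r : ℝ} (r₁ : ℝ) (h : CleanTextureFloor r) : MonoTextureFloor r r₁ 0 :=
  ((cleanTextureFloor_iff_mono_and_poly r r₁).1 h).1

/-- NECESSITY: the near-fault piece at floor `0` is a restriction of the elastic piece. [folklore] -/
theorem polyTextureFloor_zero_of_cleanTextureFloor {r : ℝ} (r₁ : ℝ) (h : CleanTextureFloor r) : PolyTextureFloor r r₁ 0 :=
  ((cleanTextureFloor_iff_mono_and_poly r r₁).1 h).2

/-- NECESSITY: the far-fault piece at floor `0` is a restriction of the elastic piece. [folklore] -/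
theorem annularPhaseFloor_zero_of_cleanTextureFloor {r : ℝ} (r₁ r₂ : ℝ) (h : CleanTextureFloor r) : AnnularPhaseFloor r r₁ r₂ 0 :=
  fun M z c hz hcl _ _ => h M z c hz hcl

/-- SEAM: `MonoTextureFloor r r₁ φ₁ → PolyTextureFloor r r₁ φ₂ → 0 ≤ φ₁ → 0 ≤ φ₂ → CleanTextureFloor r`. [folklore] -/
theorem cleanTextureFloor_of_mono_of_poly {r r₁ φ₁ φ₂ : ℝ} (hM : MonoTextureFloor r r₁ φ₁) (hP : PolyTextureFloor r r₁ φ₂) (h₁ : 0 ≤ φ₁)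
    (h₂ : 0 ≤ φ₂) : CleanTextureFloor r :=
  (cleanTextureFloor_iff_mono_and_poly r r₁).2
    ⟨fun M z c hz hcl hm => h₁.trans (hM M z c hz hcl hm), fun M z c hz hcl hm => h₂.trans (hP M z c hz hcl hm)⟩

/-- DIALS: floors antitone; `MonoTextureFloor` WEAKENS and `PolyTextureFloor` STRENGTHENS as the word radius `r₁` grows; both monotone in `r`. [folklore] -/
theorem MonoTextureFloor.of_le {r r₁ φ φ' : ℝ} (h : MonoTextureFloor r r₁ φ) (hle : φ' ≤ φ) : MonoTextureFloor r r₁ φ' :=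
  fun M z c hz hcl hm => hle.trans (h M z c hz hcl hm)

/-- Monotonicity bookkeeping (`PolyTextureFloor.of_le`). -/
theorem PolyTextureFloor.of_le {r r₁ φ φ' : ℝ} (h : PolyTextureFloor r r₁ φ) (hle : φ' ≤ φ) : PolyTextureFloor r r₁ φ' :=
  fun M z c hz hcl hm => hle.trans (h M z c hz hcl hm)

/-- Monotonicity bookkeeping (`MonoTextureFloor.of_le_word`). -/
theorem MonoTextureFloor.of_le_word {r r₁ r₁' φ : ℝ} (h : MonoTextureFloor r r₁ φ) (hle : r₁ ≤ r₁') : MonoTextureFloor r r₁' φ :=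
  fun M z c hz hcl hm => h M z c hz hcl (hm.mono hle)

/-- Monotonicity bookkeeping (`PolyTextureFloor.of_le_word`). -/
theorem PolyTextureFloor.of_le_word {r r₁ r₁' φ : ℝ} (h : PolyTextureFloor r r₁' φ) (hle : r₁ ≤ r₁') : PolyTextureFloor r r₁ φ :=
  fun M z c hz hcl hm => h M z c hz hcl fun hm' => hm (hm'.mono hle)

/-- Monotonicity bookkeeping (`MonoTextureFloor.of_le_radius`). -/
theorem MonoTextureFloor.of_le_radius {r r' r₁ φ : ℝ} (h : MonoTextureFloor r r₁ φ) (hle : r ≤ r') : MonoTextureFloor r' r₁ φ :=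
  fun M z c hz hcl hm => h M z c hz (hcl.mono hle) hm

/-- Monotonicity bookkeeping (`PolyTextureFloor.of_le_radius`). -/
theorem PolyTextureFloor.of_le_radius {r r' r₁ φ : ℝ} (h : PolyTextureFloor r r₁ φ) (hle : r ≤ r') : PolyTextureFloor r' r₁ φ :=
  fun M z c hz hcl hm => h M z c hz (hcl.mono hle) hm

/-- Monotonicity bookkeeping (`AnnularPhaseFloor.of_le`). -/
theorem AnnularPhaseFloor.of_le {r r₁ r₂ φ φ' : ℝ} (h : AnnularPhaseFloor r r₁ r₂ φ) (hle : φ' ≤ φ) : AnnularPhaseFloor r r₁ r₂ φ' :=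
  fun M z c hz hcl h₁ h₂ => hle.trans (h M z c hz hcl h₁ h₂)

/-- ★ PHASE LADDER, pure side: `MonoTextureFloor r r₁ φ ↔ MonoTextureFloor r r₂ φ ∧ AnnularPhaseFloor r r₁ r₂ φ` (`r₁ ≤ r₂`). [folklore] -/
theorem monoTextureFloor_iff_annular {r r₁ r₂ φ : ℝ} (hle : r₁ ≤ r₂) :
    MonoTextureFloor r r₁ φ ↔ MonoTextureFloor r r₂ φ ∧ AnnularPhaseFloor r r₁ r₂ φ := by
  refine ⟨fun h => ⟨h.of_le_word hle, fun M z c hz hcl h₁ _ => h M z c hz hcl h₁⟩, fun h M z c hz hcl h₁ => ?_⟩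
  by_cases h₂ : MonoPhaseBall r₂ z c
  · exact h.1 M z c hz hcl h₂
  · exact h.2 M z c hz hcl h₁ h₂

/-- ★ PHASE LADDER, fault side: `PolyTextureFloor r r₂ φ ↔ PolyTextureFloor r r₁ φ ∧ AnnularPhaseFloor r r₁ r₂ φ` (`r₁ ≤ r₂`). [folklore] -/
theorem polyTextureFloor_iff_annular {r r₁ r₂ φ : ℝ} (hle : r₁ ≤ r₂) :
    PolyTextureFloor r r₂ φ ↔ PolyTextureFloor r r₁ φ ∧ AnnularPhaseFloor r r₁ r₂ φ := by
  refine ⟨fun h => ⟨h.of_le_word hle, fun M z c hz hcl _ h₂ => h M z c hz hcl h₂⟩, fun h M z c hz hcl h₂ => ?_⟩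
  by_cases h₁ : MonoPhaseBall r₁ z c
  · exact h.2 M z c hz hcl h₁ h₂
  · exact h.1 M z c hz hcl h₁

/-- ★ THREE PHASE REGIMES (`r₁ ≤ r₂`): `CleanTextureFloorAt r φ ↔ MonoTextureFloor r r₂ φ ∧ AnnularPhaseFloor r r₁ r₂ φ ∧ PolyTextureFloor r r₁ φ` —
PURE STACKING out to `r₂` ∧ FAR-FAULT (pure out to `r₁`, word change in the annulus) ∧ NEAR-FAULT (word change within `r₁`). [folklore] -/
theorem cleanTextureFloorAt_iff_three_phases {r r₁ r₂ φ : ℝ} (hle : r₁ ≤ r₂) :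
    CleanTextureFloorAt r φ ↔ MonoTextureFloor r r₂ φ ∧ AnnularPhaseFloor r r₁ r₂ φ ∧ PolyTextureFloor r r₁ φ := by
  rw [cleanTextureFloorAt_iff_mono_and_poly r r₂ φ, polyTextureFloor_iff_annular hle]
  tauto

/-! ## §5. The isometry-quotiented tube INSIDE the pure-stacking piece: the gradient branch -/

/-- **`MonoTubeFloor r r₁ ε` [TUBE inside pure stacking; (H) + relief]** -/
def MonoTubeFloor (r r₁ ε : ℝ) : Prop :=
  ∀ (M : ℕ) (z : Fin M → E3) (c : Fin M), Admissible M z c → CleanBall r z c → MonoPhaseBall r₁ z c → NearHomIso ε z c →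
    0 ≤ ballAvg (9 / 5) z (xRec M z) c

/-- **`MonoOffTubeFloor r r₁ ε φ` [OT-G, GRADIENT branch; the residual]** — on admissible clusters clean within `r`, pure word out to `r₁`, at isometry-distance
`≥ ε` from every admissible homogeneous instance (non-affine single crystals), the score is `≥ φ`. -/
def MonoOffTubeFloor (r r₁ ε φ : ℝ) : Prop :=
  ∀ (M : ℕ) (z : Fin M → E3) (c : Fin M), Admissible M z c → CleanBall r z c → MonoPhaseBall r₁ z c → ¬NearHomIso ε z c →
    φ ≤ ballAvg (9 / 5) z (xRec M z) c

/-- ★ EXACT CUT of the pure-stacking piece: `MonoTextureFloor r r₁ 0 ↔ MonoTubeFloor r r₁ ε ∧ MonoOffTubeFloor r r₁ ε 0`. [folklore: `em` on `NearHomIso ε`] -/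
theorem monoTextureFloor_zero_iff_tube_and_offTube (r r₁ ε : ℝ) :
    MonoTextureFloor r r₁ 0 ↔ MonoTubeFloor r r₁ ε ∧ MonoOffTubeFloor r r₁ ε 0 := by
  constructor
  · intro h
    exact ⟨fun M z c hz hcl hm _ => h M z c hz hcl hm, fun M z c hz hcl hm _ => h M z c hz hcl hm⟩
  · rintro ⟨hT, hO⟩ M z c hz hcl hm
    by_cases hn : NearHomIso ε z c
    · exact hT M z c hz hcl hm hn
    · exact hO M z c hz hcl hm hn

/-- NECESSITY of both. [folklore] -/
theorem monoTubeFloor_of_monoTextureFloor_zero {r r₁ : ℝ} (ε : ℝ) (h : MonoTextureFloor r r₁ 0) : MonoTubeFloor r r₁ ε :=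
  ((monoTextureFloor_zero_iff_tube_and_offTube r r₁ ε).1 h).1

/-- Necessity bookkeeping (`monoOffTubeFloor_zero_of_monoTextureFloor_zero`). -/
theorem monoOffTubeFloor_zero_of_monoTextureFloor_zero {r r₁ : ℝ} (ε : ℝ) (h : MonoTextureFloor r r₁ 0) : MonoOffTubeFloor r r₁ ε 0 :=
  ((monoTextureFloor_zero_iff_tube_and_offTube r r₁ ε).1 h).2

/-- SEAM: `MonoTubeFloor r r₁ ε → MonoOffTubeFloor r r₁ ε φ → 0 ≤ φ → MonoTextureFloor r r₁ 0`. [folklore] -/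
theorem monoTextureFloor_zero_of_tube_of_offTube {r r₁ ε φ : ℝ} (hT : MonoTubeFloor r r₁ ε) (hO : MonoOffTubeFloor r r₁ ε φ) (hφ : 0 ≤ φ) :
    MonoTextureFloor r r₁ 0 :=
  (monoTextureFloor_zero_iff_tube_and_offTube r r₁ ε).2 ⟨hT, fun M z c hz hcl hm hn => hφ.trans (hO M z c hz hcl hm hn)⟩

/-- The quotiented tube piece gives the pure-stacking tube piece (drop the word hypothesis). [formal bookkeeping] -/
theorem monoTubeFloor_of_tubeFloorIso {r ε : ℝ} (r₁ : ℝ) (h : TubeFloorIso r ε) : MonoTubeFloor r r₁ ε :=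
  fun M z c hz hcl _ hn => h M z c hz hcl hn

/-- ★ (H) + tube relief discharge the pure-stacking tube: `HomFloor m → TubeRelief r ε L B → L·σ₁ + B ≤ m → MonoTubeFloor r r₁ ε`. [folklore] -/
theorem monoTubeFloor_of_homFloor_of_tubeRelief {m r r₁ ε L B : ℝ} (hH : HomFloor m) (hR : TubeRelief r ε L B) (hm : L * sigmaOne + B ≤ m) :
    MonoTubeFloor r r₁ ε :=
  monoTubeFloor_of_tubeFloorIso r₁ (tubeFloorIso_of_homFloor_of_tubeRelief hH hR hm)

/-- The repaired off-tube piece gives the gradient branch (so [OT-G] is WEAKER than §A's [OT]). [formal bookkeeping] -/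
theorem monoOffTubeFloor_of_offTubeFloorIso {r ε φ : ℝ} (r₁ : ℝ) (h : OffTubeFloorIso r ε φ) : MonoOffTubeFloor r r₁ ε φ :=
  fun M z c hz hcl _ hn => h M z c hz hcl hn

/-- ★ CONSERVATIVE LINK back to §A: `MonoOffTubeFloor r r₁ ε φ → PolyTextureFloor r r₁ φ → OffTubeFloorIso r ε φ`. [folklore: `em` on the word] -/
theorem offTubeFloorIso_of_monoOffTube_of_poly {r r₁ ε φ : ℝ} (hG : MonoOffTubeFloor r r₁ ε φ) (hP : PolyTextureFloor r r₁ φ) :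
    OffTubeFloorIso r ε φ := by
  intro M z c hz hcl hn
  by_cases hm : MonoPhaseBall r₁ z c
  · exact hG M z c hz hcl hm hn
  · exact hP M z c hz hcl hm

/-- DIALS of the gradient branch: antitone in `φ`, monotone in `ε`, weakens as `r₁` grows, monotone in `r`. [folklore] -/
theorem MonoOffTubeFloor.of_le {r r₁ ε φ φ' : ℝ} (h : MonoOffTubeFloor r r₁ ε φ) (hle : φ' ≤ φ) : MonoOffTubeFloor r r₁ ε φ' :=
  fun M z c hz hcl hm hn => hle.trans (h M z c hz hcl hm hn)

/-- Monotonicity bookkeeping (`MonoOffTubeFloor.mono`). -/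
theorem MonoOffTubeFloor.mono {r r₁ ε ε' φ : ℝ} (h : MonoOffTubeFloor r r₁ ε φ) (hle : ε ≤ ε') : MonoOffTubeFloor r r₁ ε' φ :=
  fun M z c hz hcl hm hn => h M z c hz hcl hm fun hn' => hn (hn'.mono hle)

/-- Monotonicity bookkeeping (`MonoOffTubeFloor.of_le_word`). -/
theorem MonoOffTubeFloor.of_le_word {r r₁ r₁' ε φ : ℝ} (h : MonoOffTubeFloor r r₁ ε φ) (hle : r₁ ≤ r₁') : MonoOffTubeFloor r r₁' ε φ :=
  fun M z c hz hcl hm hn => h M z c hz hcl (hm.mono hle) hn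

/-- Monotonicity bookkeeping (`MonoOffTubeFloor.of_le_radius`). -/
theorem MonoOffTubeFloor.of_le_radius {r r' r₁ ε φ : ℝ} (h : MonoOffTubeFloor r r₁ ε φ) (hle : r ≤ r') : MonoOffTubeFloor r' r₁ ε φ :=
  fun M z c hz hcl hm hn => h M z c hz (hcl.mono hle) hm hn

/-! ## §6. The nodes -/

/-- ★ FOUR-PIECE ELASTIC NODE (`r₁ ≤ r₂`, floors `≥ 0`):
`MonoTubeFloor r r₂ ε → MonoOffTubeFloor r r₂ ε φ₁ → AnnularPhaseFloor r r₁ r₂ φ₂ → PolyTextureFloor r r₁ φ₃ → CleanTextureFloor r`. [folklore] -/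
theorem cleanTextureFloor_of_monoTube_of_monoOffTube_of_annularPhase_of_poly {r r₁ r₂ ε φ₁ φ₂ φ₃ : ℝ} (hT : MonoTubeFloor r r₂ ε)
    (hG : MonoOffTubeFloor r r₂ ε φ₁) (hF : AnnularPhaseFloor r r₁ r₂ φ₂) (hP : PolyTextureFloor r r₁ φ₃) (hle : r₁ ≤ r₂) (h₁ : 0 ≤ φ₁)
    (h₂ : 0 ≤ φ₂) (h₃ : 0 ≤ φ₃) : CleanTextureFloor r :=
  (cleanTextureFloorAt_iff_three_phases hle).2 ⟨monoTextureFloor_zero_of_tube_of_offTube hT hG h₁, hF.of_le h₂, hP.of_le h₃⟩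

/-- ★★ THE NODE (six regimes, record radii `r = r₂ = 63/10`, `r₁ = 24/5`): `MonoTubeFloor → MonoOffTubeFloor (φ₁) → AnnularPhaseFloor (φ₂) → PolyTextureFloor (φ₃)
→ AnnularDefectFloor (24/5) (63/10) → DefectiveCollarFloor (24/5) → StrainedPatchRec` (floors `≥ 0`). [folklore] -/
theorem strainedPatchRec_of_monoTube_of_monoOffTube_of_annularPhase_of_poly_of_annular_of_near {ε φ₁ φ₂ φ₃ : ℝ}
    (hT : MonoTubeFloor (63 / 10) (63 / 10) ε) (hG : MonoOffTubeFloor (63 / 10) (63 / 10) ε φ₁)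
    (hF : AnnularPhaseFloor (63 / 10) (24 / 5) (63 / 10) φ₂) (hP : PolyTextureFloor (63 / 10) (24 / 5) φ₃) (h₁ : 0 ≤ φ₁) (h₂ : 0 ≤ φ₂)
    (h₃ : 0 ≤ φ₃) (hA : AnnularDefectFloor (24 / 5) (63 / 10)) (hD : DefectiveCollarFloor (24 / 5)) : StrainedPatchRec :=
  strainedPatchRec_iff_record_regimes.2
    ⟨cleanTextureFloor_of_monoTube_of_monoOffTube_of_annularPhase_of_poly hT hG hF hP (by norm_num) h₁ h₂ h₃, hA, hD⟩

/-- ★★ RECORD NODE (record literals; the [OT-G] / [FF] floors `1/1000` PROVISIONAL pending census L5-ASK4b):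
`HomFloor (1/625) → TubeRelief (63/10) (1/100) 0 (1/1000) → MonoOffTubeFloor (63/10) (63/10) (1/100) (1/1000) → AnnularPhaseFloor (63/10) (24/5) (63/10) (1/1000) →
PolyTextureFloor (63/10) (24/5) (1/1000) → AnnularDefectFloor (24/5) (63/10) → DefectiveCollarFloor (24/5) → StrainedPatchRec`. -/
theorem strainedPatchRec_of_homFloor_625_of_tubeRelief_milli_of_monoOffTube_of_annularPhase_of_poly_of_annular_of_near
    (hH : HomFloor (1 / 625)) (hR : TubeRelief (63 / 10) (1 / 100) 0 (1 / 1000)) (hG : MonoOffTubeFloor (63 / 10) (63 / 10) (1 / 100) (1 / 1000))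
    (hF : AnnularPhaseFloor (63 / 10) (24 / 5) (63 / 10) (1 / 1000)) (hP : PolyTextureFloor (63 / 10) (24 / 5) (1 / 1000))
    (hA : AnnularDefectFloor (24 / 5) (63 / 10)) (hD : DefectiveCollarFloor (24 / 5)) : StrainedPatchRec :=
  strainedPatchRec_of_monoTube_of_monoOffTube_of_annularPhase_of_poly_of_annular_of_near
    (monoTubeFloor_of_homFloor_of_tubeRelief hH hR seam_arith_tube) hG hF hP (by norm_num) (by norm_num) (by norm_num) hA hD

/-- ★★ … and as the `h1` hypothesis of `…CollarCensusZeroFree.aperiodicFrustratedLawGap_of_collarPiecesKK_milli_unionT_zero_free`. -/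
theorem strainedPatch_of_homFloor_625_of_tubeRelief_milli_of_monoOffTube_of_annularPhase_of_poly_of_annular_of_near
    (hH : HomFloor (1 / 625)) (hR : TubeRelief (63 / 10) (1 / 100) 0 (1 / 1000)) (hG : MonoOffTubeFloor (63 / 10) (63 / 10) (1 / 100) (1 / 1000))
    (hF : AnnularPhaseFloor (63 / 10) (24 / 5) (63 / 10) (1 / 1000)) (hP : PolyTextureFloor (63 / 10) (24 / 5) (1 / 1000))
    (hA : AnnularDefectFloor (24 / 5) (63 / 10)) (hD : DefectiveCollarFloor (24 / 5)) :
    StrainedPatchMotifPricingCapXK (1 / 1000) (9 / 5) (133 / 10) (3 / 2) (effPot w₄₅ ω₄ (3 / 400)) (-(7175 / 10000) + 3 / 400)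
      (Collar (9 / 2) fun N y j => (∃ s : ℝ, 0 ≤ s ∧ s ≤ 3 / 2 ∧ NonEquilibriumCore (-(7175 / 10000)) 0 7 s (1 / 10000) N y j) ∨
        GoodAtScale (1 / 20) (3 / 2) y j) :=
  strainedPatch_iff.1
    (strainedPatchRec_of_homFloor_625_of_tubeRelief_milli_of_monoOffTube_of_annularPhase_of_poly_of_annular_of_near hH hR hG hF hP hA hD)

/-- The g45 HomTube record node follows from the repaired one (its [OT] is stronger): nothing proved before is lost. [formal bookkeeping] -/
theorem strainedPatchRec_of_homTube_record (hH : HomFloor (1 / 625)) (hR : TubeRelief (63 / 10) (1 / 100) 0 (1 / 1000))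
    (hO : OffTubeFloor (63 / 10) (1 / 100) (1 / 1000)) (hA : AnnularDefectFloor (24 / 5) (63 / 10)) (hD : DefectiveCollarFloor (24 / 5)) :
    StrainedPatchRec :=
  strainedPatchRec_of_homFloor_625_of_tubeRelief_milli_of_offTubeIso_of_annular_of_near hH hR (offTubeFloorIso_of_offTubeFloor hO) hA hD

end Summit.AtomisticToContinuum.Crystallization.Theorems.FrustratedLawDichotomyStrainedPatchPhaseCut
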